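import Mathlib.Algebra.Polynomial.Laurent
import Mathlib.RingTheory.MvPolynomial.Basic
import Mathlib.RingTheory.Ideal.Quotient.Operations
import Mathlib.Algebra.MonoidAlgebra.NoZeroDivisors
import HarnessLib

/-!
# The suspension kernel `(yz + f) = ker (A[y,z] → A[T, T⁻¹])` (crux `FrobeniusLadder.FRationalResolution`, line `Sketch`)

Stub `stub_suspensionKernel` (worker W4) of the skeleton `Sketch` for crux
stmt-ResolutionOfSingularities-15317 (suspension calibration). Let `A` be a domain, `f ∈ A`
non-zero, `g = yz + f ∈ A[y,z] = MvPolynomial (Fin 2) A` (`y = X 0`, `z = X 1`). Consider the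
`A`-algebra map `ψ : A[y,z] → A[T, T⁻¹]`, `y ↦ T`, `z ↦ -f T⁻¹`
(`MvPolynomial.aeval ![T 1, -(C f * T (-1))]`).

* `ψ g = 0` (`aeval_suspension_eq_zero`);
* the `T^D`-coefficient of `ψ c` is the "Laurent coefficient"
  `T_D(c) = Σ_{m ∈ supp c, m₀ − m₁ = D} (−1)^(m₁) c_m f^(m₁)` (`coeff_aeval_suspension`);
* every monomial `y^a z^b` is congruent modulo `g` to `(−f)^(min a b) · y^(a−b)` or
  `(−f)^(min a b) · z^(b−a)` (`monomial_sub_normalForm_mem`), so every `c` is congruent to a normal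
  form supported on monomials `m` with `m₀ = 0 ∨ m₁ = 0` (`exists_normalForm`), and `ψ` is injective
  on normal forms because `A` is a domain and `f ≠ 0` (`normalForm_eq_zero`);
* hence `ker ψ = (g)` (`span_suspension_eq_ker`), `(g)` is prime (`A[T,T⁻¹]` is a domain), and every
  `c ∉ (g)` has `ψ c ≠ 0`, i.e. some `T_D(c) ≠ 0` (`stub_suspensionKernel`).
-/

set_option linter.dupNamespace false
-- single-problem summit: the doubled namespace component is forced

namespace Summit.ResolutionOfSingularities.ResolutionOfSingularities.Theorems.FRationalResolution

open MvPolynomial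
open scoped BigOperators LaurentPolynomial

/-- The substitution `y ↦ T`, `z ↦ -f T⁻¹` kills `yz + f`. -/
theorem aeval_suspension_eq_zero (A : Type) [CommRing A] (f : A) :
    MvPolynomial.aeval ![LaurentPolynomial.T 1, -(LaurentPolynomial.C f * LaurentPolynomial.T (-1))]
      (X 0 * X 1 + C f : MvPolynomial (Fin 2) A) = 0 := by
  simp only [map_add, map_mul, aeval_X, Matrix.cons_val_zero, Matrix.cons_val_one, algHom_C]
  rw [LaurentPolynomial.algebraMap_apply]
  simp

/-- The substitution `y ↦ T`, `z ↦ -f T⁻¹` on a monomial: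
`a y^(m₀) z^(m₁) ↦ a (−1)^(m₁) f^(m₁) T^(m₀ − m₁)`. -/
theorem aeval_suspension_monomial (A : Type) [CommRing A] (f : A) (m : Fin 2 →₀ ℕ) (a : A) :
    MvPolynomial.aeval ![LaurentPolynomial.T 1, -(LaurentPolynomial.C f * LaurentPolynomial.T (-1))]
      (monomial m a) = LaurentPolynomial.C (a * ((-1) ^ (m 1) * f ^ (m 1))) *
      LaurentPolynomial.T ((m 0 : ℤ) - (m 1 : ℤ)) := by
  simp only [aeval_monomial, LaurentPolynomial.algebraMap_apply, Algebra.algebraMap_self,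
    RingHom.id_apply]
  rw [Finsupp.prod_fintype _ _ (by simp), Fin.prod_univ_two]
  simp only [Matrix.cons_val_zero, Matrix.cons_val_one]
  rw [neg_pow, LaurentPolynomial.T_pow, mul_pow, ← map_pow, LaurentPolynomial.T_pow,
    LaurentPolynomial.T_sub, mul_one, mul_neg_one, map_mul, map_mul, map_pow LaurentPolynomial.C,
    map_pow LaurentPolynomial.C, map_neg LaurentPolynomial.C, map_one LaurentPolynomial.C]
  ring

/-- THE LAURENT COEFFICIENT: the `T^D`-coefficient of `c(T, −f/T)` is
`T_D(c) = Σ_{m ∈ supp c, m₀ − m₁ = D} (−1)^(m₁) c_m f^(m₁)`. -/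
theorem coeff_aeval_suspension (A : Type) [CommRing A] (f : A) (c : MvPolynomial (Fin 2) A)
    (D : ℤ) :
    (MvPolynomial.aeval
      ![LaurentPolynomial.T 1, -(LaurentPolynomial.C f * LaurentPolynomial.T (-1))] c).coeff D =
      ∑ m ∈ c.support with ((m 0 : ℤ) - (m 1 : ℤ) = D),
        (-1) ^ (m 1) * MvPolynomial.coeff m c * f ^ (m 1) := by
  conv_lhs => rw [c.as_sum]
  rw [map_sum, AddMonoidAlgebra.coeff_sum, Finsupp.finsetSum_apply, Finset.sum_filter]
  refine Finset.sum_congr rfl fun m _ => ?_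
  rw [aeval_suspension_monomial, ← LaurentPolynomial.single_eq_C_mul_T,
    AddMonoidAlgebra.coeff_single, Finsupp.single_apply]
  split_ifs
  · ring
  · rfl

/-- MONOMIAL REDUCTION: `y^(M₀ + k) z^(M₁ + k) · a ≡ y^(M₀) z^(M₁) · (−f)^k a` modulo `(yz + f)`. -/
theorem monomial_sub_normalForm_mem (A : Type) [CommRing A] (f : A) (M : Fin 2 →₀ ℕ) (k : ℕ)
    (a : A) :
    monomial (M + k • (Finsupp.single 0 1 + Finsupp.single 1 1)) a - monomial M ((-f) ^ k * a) ∈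
      Ideal.span {(X 0 * X 1 + C f : MvPolynomial (Fin 2) A)} := by
  induction k generalizing a with
  | zero => simp
  | succ k ih =>
    have key : monomial (M + (k + 1) • (Finsupp.single 0 1 + Finsupp.single 1 1)) a =
        monomial (M + k • (Finsupp.single 0 1 + Finsupp.single 1 1)) a * (X 0 * X 1 + C f) +
          monomial (M + k • (Finsupp.single 0 1 + Finsupp.single 1 1)) (-f * a) := by
      rw [succ_nsmul, ← add_assoc]
      simp only [X, C_apply, monomial_mul, mul_add, add_zero, mul_one]
      rw [add_assoc (G := MvPolynomial (Fin 2) A), ← map_add, show a * f + -f * a = 0 by ring,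
        map_zero, add_zero]
    rw [key, pow_succ, mul_assoc, add_sub_assoc]
    exact Ideal.add_mem _ (Ideal.mul_mem_left _ _ (Ideal.mem_span_singleton_self _)) (ih (-f * a))

/-- NORMAL FORM: every `c ∈ A[y,z]` is congruent modulo `(yz + f)` to a polynomial supported on the
monomials `y^D` (`D ≥ 0`) and `z^D` (`D > 0`). -/
theorem exists_normalForm (A : Type) [CommRing A] (f : A) (c : MvPolynomial (Fin 2) A) :
    ∃ n : MvPolynomial (Fin 2) A, (∀ m ∈ n.support, m 0 = 0 ∨ m 1 = 0) ∧
      c - n ∈ Ideal.span {(X 0 * X 1 + C f : MvPolynomial (Fin 2) A)} := by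
  induction c using MvPolynomial.induction_on' with
  | monomial m a =>
    set k : ℕ := min (m 0) (m 1)
    set M : Fin 2 →₀ ℕ := Finsupp.single 0 (m 0 - k) + Finsupp.single 1 (m 1 - k) with hM
    have hm : m = M + k • (Finsupp.single 0 1 + Finsupp.single 1 1) := by
      ext i
      fin_cases i <;> simp [hM] <;> omega
    refine ⟨monomial M ((-f) ^ k * a), fun m' hm' => ?_, ?_⟩
    · have h' : m' = M := Finset.mem_singleton.mp (support_monomial_subset hm')
      subst h'
      simp [hM]
      omega
    · rw [hm]
      exact monomial_sub_normalForm_mem A f M k a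
  | add p q hp hq =>
    obtain ⟨n₁, hn₁, hpn₁⟩ := hp
    obtain ⟨n₂, hn₂, hqn₂⟩ := hq
    refine ⟨n₁ + n₂, fun m hm => ?_, ?_⟩
    · classical
      rcases Finset.mem_union.mp (support_add hm) with h | h
      · exact hn₁ m h
      · exact hn₂ m h
    · rw [add_sub_add_comm]
      exact Ideal.add_mem _ hpn₁ hqn₂

/-- INJECTIVITY ON NORMAL FORMS: a polynomial supported on the monomials `y^D`, `z^D` and killed by
`y ↦ T`, `z ↦ −f T⁻¹` vanishes (`A` a domain, `f ≠ 0`: its `T^(±D)`-coefficients are `c_(D,0)` and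
`(−f)^D c_(0,D)`). -/
theorem normalForm_eq_zero (A : Type) [CommRing A] [IsDomain A] (f : A) (hf : f ≠ 0)
    (n : MvPolynomial (Fin 2) A) (hn : ∀ m ∈ n.support, m 0 = 0 ∨ m 1 = 0)
    (hψ : MvPolynomial.aeval
      ![LaurentPolynomial.T 1, -(LaurentPolynomial.C f * LaurentPolynomial.T (-1))] n = 0) :
    n = 0 := by
  rw [MvPolynomial.eq_zero_iff]
  intro d
  by_contra hd
  have hd' : d ∈ n.support := mem_support_iff.mpr hd
  have h := congrArg (fun p : LaurentPolynomial A => p.coeff ((d 0 : ℤ) - (d 1 : ℤ))) hψ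
  simp only [AddMonoidAlgebra.coeff_zero, Finsupp.coe_zero, Pi.zero_apply] at h
  have hmem : d ∈ n.support.filter (fun m => (m 0 : ℤ) - (m 1 : ℤ) = (d 0 : ℤ) - (d 1 : ℤ)) :=
    Finset.mem_filter.mpr ⟨hd', rfl⟩
  rw [coeff_aeval_suspension, Finset.sum_eq_single_of_mem d hmem] at h
  · rcases mul_eq_zero.mp h with h | h
    · rcases mul_eq_zero.mp h with h | h
      · exact (pow_ne_zero _ (neg_ne_zero.mpr (one_ne_zero (α := A)))) h
      · exact hd h
    · exact pow_ne_zero _ hf h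
  · intro b hb hbd
    exfalso
    apply hbd
    obtain ⟨hb, hbD⟩ := Finset.mem_filter.mp hb
    have h1 := hn b hb
    have h2 := hn d hd'
    ext i
    fin_cases i <;> simp <;> omega

/-- `ker ψ ≤ (yz + f)`: a polynomial killed by `y ↦ T`, `z ↦ −f T⁻¹` is a multiple of `yz + f`. -/
theorem mem_span_suspension_of_aeval_eq_zero (A : Type) [CommRing A] [IsDomain A] (f : A)
    (hf : f ≠ 0) (c : MvPolynomial (Fin 2) A)
    (hψ : MvPolynomial.aeval
      ![LaurentPolynomial.T 1, -(LaurentPolynomial.C f * LaurentPolynomial.T (-1))] c = 0) :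
    c ∈ Ideal.span {(X 0 * X 1 + C f : MvPolynomial (Fin 2) A)} := by
  obtain ⟨n, hn, hcn⟩ := exists_normalForm A f c
  have hψ' : MvPolynomial.aeval
      ![LaurentPolynomial.T 1, -(LaurentPolynomial.C f * LaurentPolynomial.T (-1))] (c - n) =
        0 := by
    obtain ⟨a, ha⟩ := Ideal.mem_span_singleton'.mp hcn
    rw [← ha, map_mul, aeval_suspension_eq_zero, mul_zero]
  have hn0 : n = 0 := by
    refine normalForm_eq_zero A f hf n hn ?_
    have e : n = c - (c - n) := by ring
    rw [e, map_sub, hψ, hψ', sub_zero]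
  rw [hn0, sub_zero] at hcn
  exact hcn

/-- `(yz + f) = ker (A[y,z] → A[T,T⁻¹], y ↦ T, z ↦ −f T⁻¹)` for `A` a domain and `f ≠ 0`. -/
theorem span_suspension_eq_ker (A : Type) [CommRing A] [IsDomain A] (f : A) (hf : f ≠ 0) :
    Ideal.span {(X 0 * X 1 + C f : MvPolynomial (Fin 2) A)} =
      RingHom.ker (MvPolynomial.aeval
        ![LaurentPolynomial.T 1, -(LaurentPolynomial.C f * LaurentPolynomial.T (-1))] :
          MvPolynomial (Fin 2) A →ₐ[A] LaurentPolynomial A) := by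
  refine le_antisymm ?_ fun c hc => ?_
  · rw [Ideal.span_le, Set.singleton_subset_iff, SetLike.mem_coe, RingHom.mem_ker]
    exact aeval_suspension_eq_zero A f
  · exact mem_span_suspension_of_aeval_eq_zero A f hf c (RingHom.mem_ker.mp hc)

/-- STUB `stub_suspensionKernel` (worker W4): for a domain `A` and `f ≠ 0`, the ideal `(yz + f)` of
`A[y,z]` is prime (it is the kernel of `y ↦ T`, `z ↦ −f T⁻¹` into the domain `A[T,T⁻¹]`), and every
`c ∉ (yz + f)` has a non-zero Laurent coefficient
`T_D(c) = Σ_{m ∈ supp c, m₀ − m₁ = D} (−1)^(m₁) c_m f^(m₁)` for some `D ∈ ℤ`. -/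
theorem stub_suspensionKernel (A : Type) [CommRing A] [IsDomain A] (f : A) (hf : f ≠ 0) :
    (Ideal.span {(MvPolynomial.X 0 * MvPolynomial.X 1 + MvPolynomial.C f :
        MvPolynomial (Fin 2) A)}).IsPrime ∧
    ∀ c : MvPolynomial (Fin 2) A,
      c ∉ Ideal.span {(MvPolynomial.X 0 * MvPolynomial.X 1 + MvPolynomial.C f :
        MvPolynomial (Fin 2) A)} →
      ∃ D : ℤ, (∑ m ∈ c.support with ((m 0 : ℤ) - (m 1 : ℤ) = D),
          (-1) ^ (m 1) * MvPolynomial.coeff m c * f ^ (m 1)) ≠ 0 := by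
  refine ⟨?_, fun c hc => ?_⟩
  · rw [span_suspension_eq_ker A f hf]
    exact RingHom.ker_isPrime _
  · have hψ : MvPolynomial.aeval
        ![LaurentPolynomial.T 1, -(LaurentPolynomial.C f * LaurentPolynomial.T (-1))] c ≠ 0 :=
      fun h => hc (mem_span_suspension_of_aeval_eq_zero A f hf c h)
    by_contra hD
    push Not at hD
    apply hψ
    ext D
    rw [coeff_aeval_suspension, hD D]
    simp

end Summit.ResolutionOfSingularities.ResolutionOfSingularities.Theorems.FRationalResolution
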